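import Mathlib
import HarnessLib
import Summits.HubbardSuperconductivity.HubbardSuperconductivity.Theorems.KLProgrammeKLRegimeEngineV8PairTransferRelDefs

/-!
# Route `KLProgramme` — ENGINE child gen 8 (stmt-HubbardSuperconductivity-20437 `KLRegimeEngineV17F2`), skeleton v2 class #5 rev 3 «relative family»: the BORN-OVERLAP weight
# inherits ZERO — `klShellOverlap … n D = 0` for every symbol `D` living below the NEXT scale (cell gate-hubbard-kl, seat hubbard-kl-p1 g12 = EdgeFacts lane;
# the support fact behind CLASS5-DEFECT-BUDGET-2 §3 (W_fl) and k3c1-p1's `transferBarRelAt_succ_room`)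

WHY.  The relative bar's floor part is weighted by the born-overlap `klShellOverlap … n (ψ₁ − ψ₂)` (p585429): the soft mass of the difference symbol carried by the scale-`n`
transition band `Λₙ²/4 ≤ ω² + e_K² ≤ Λₙ²`.  Its point is that it is NOT inherited: a pair still admissible at the deeper scale `n+1` has its difference `D` supported where
`w_{Λ_{n+1}} < 1`, i.e. on `ω² + e_K² < Λ_{n+1}² = Λₙ²/16`, which is disjoint from the scale-`n` band (`≥ Λₙ²/4`).  So `klShellOverlap … n D = 0` EXACTLY — the inherited floor
term of the relative step vanishes, whatever the bar's coefficient there.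
* `sq_lt_of_lt_one_sub_hubbardCutoffWeightCT` (`w_Λ(k) < 1 ⇒ ω² + e_K² < Λ²`), `abs_le_one_sub_weight_of_ordered` (ordered admissible pair ⇒ `|ψ₁ − ψ₂| ≤ 1 − w_{Λ}`),
  **`klShellOverlap_eq_zero_of_soft_succ`** (`|D| ≤ 1 − w_{Λ_{n+1}}` pointwise ⇒ `klShellOverlap … n D = 0`), **`klShellOverlap_eq_zero_of_ordered_succ`** (the pair form),
  `klShellOverlap_le_of_isSoftSymbol` (at its own scale `≤ 15367`).
Elementary support facts; nothing about the effective action is asserted.  0 kit.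
-/

noncomputable section

namespace Summit.HubbardSuperconductivity.HubbardSuperconductivity.Theorems.KLRegimeSplit

set_option linter.dupNamespace false -- summit = problem name (single-conjunct summit), D-0017

open Real Finset Literature.MathematicalPhysics.QuantumLattice Literature.Probability.LatticeModels
open Summit.HubbardSuperconductivity.HubbardSuperconductivity.Theorems.KLProgrammeLegKernels
open Summit.HubbardSuperconductivity.HubbardSuperconductivity.Theorems.TwoPointAssembly

section Support

variable {L M : ℕ} (β μ : ℝ) (K : TrigPolyC4v)

/-- Where the scale weight is not saturated the mode lies strictly below the scale: `w^K_Λ(k) < 1 ⇒ ω² + e_K² < Λ²` (`0 < Λ`). -/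
theorem sq_lt_of_hubbardCutoffWeightCT_lt_one {Λ : ℝ} (hΛ : 0 < Λ) {k : FreqMomentum L M} (h : hubbardCutoffWeightCT L M β μ K Λ k < 1) :
    matsubaraFreq β M k.1 ^ 2 + nambuXiCT L μ K k.2 ^ 2 < Λ ^ 2 := by
  by_contra hge
  push Not at hge
  have h1 : hubbardCutoffWeightCT L M β μ K Λ k = 1 := salmhoferCutoff_of_ge (by rwa [le_div_iff₀ (by positivity), one_mul])
  linarith

/-- A symbol dominated by `1 − w^K_Λ` vanishes on and above the scale: `|D k| ≤ 1 − w_Λ(k)`, `D k ≠ 0` ⇒ `ω² + e_K² < Λ²`. -/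
theorem sq_lt_of_abs_le_one_sub_weight {Λ : ℝ} (hΛ : 0 < Λ) {D : FreqMomentum L M → ℝ} {k : FreqMomentum L M}
    (hD : |D k| ≤ 1 - hubbardCutoffWeightCT L M β μ K Λ k) (hk : D k ≠ 0) : matsubaraFreq β M k.1 ^ 2 + nambuXiCT L μ K k.2 ^ 2 < Λ ^ 2 :=
  sq_lt_of_hubbardCutoffWeightCT_lt_one β μ K hΛ (by have := abs_pos.mpr hk; linarith)

/-- **An ORDERED admissible pair has a difference dominated by `1 − w`**: `0 ≤ ψ₂ ≤ ψ₁ ≤ 1 − w_Λ` pointwise ⇒ `|ψ₁ − ψ₂| ≤ 1 − w_Λ`. -/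
theorem abs_sub_le_one_sub_weight_of_ordered {Λ : ℝ} {ψ₁ ψ₂ : FreqMomentum L M → ℝ}
    (h₁ : ∀ k, 0 ≤ ψ₁ k ∧ ψ₁ k ≤ 1 - hubbardCutoffWeightCT L M β μ K Λ k) (h₂ : ∀ k, 0 ≤ ψ₂ k) (hle : ∀ k, ψ₂ k ≤ ψ₁ k) (k : FreqMomentum L M) :
    |(ψ₁ - ψ₂) k| ≤ 1 - hubbardCutoffWeightCT L M β μ K Λ k := by
  rw [Pi.sub_apply, abs_of_nonneg (by linarith [hle k])]
  linarith [(h₁ k).2, h₂ k]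

end Support

section Overlap

variable {L M : ℕ} [NeZero L] (β μ : ℝ) (K : TrigPolyC4v)

/-- **THE BORN OVERLAP INHERITS ZERO**: if `|D| ≤ 1 − w^K_{Λ_{n+1}}` pointwise (the difference of a pair still admissible at the deeper scale `n+1`), then
`klShellOverlap … n D = 0` — the scale-`n` band `Λₙ²/4 ≤ ω² + e_K² ≤ Λₙ²` and the support of `D` (`ω² + e_K² < Λ_{n+1}² = Λₙ²/16`) are disjoint. -/
theorem klShellOverlap_eq_zero_of_soft_succ (n : ℕ) {D : FreqMomentum L M → ℝ}
    (hD : ∀ k, |D k| ≤ 1 - hubbardCutoffWeightCT L M β μ K (klScale klE0 (n + 1)) k) : klShellOverlap L M β μ K n D = 0 := by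
  unfold klShellOverlap
  rw [sum_eq_zero, mul_zero]
  intro k _
  split_ifs with hband
  · by_cases hk : D k = 0
    · rw [hk, abs_zero, zero_mul]
    · exfalso
      have hlt := sq_lt_of_abs_le_one_sub_weight β μ K (klth_klScale_pos (n + 1)) (hD k) hk
      rw [klth_klScale_succ] at hlt
      have hΛ := klth_klScale_pos n
      nlinarith [hband.1]
  · rfl

/-- **Pair form**: for an ORDERED pair admissible at the deeper scale `n+1` (`0 ≤ ψ₂ ≤ ψ₁ ≤ 1 − w^K_{Λ_{n+1}}`), `klShellOverlap … n (ψ₁ − ψ₂) = 0`. -/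
theorem klShellOverlap_eq_zero_of_ordered_succ (n : ℕ) {ψ₁ ψ₂ : FreqMomentum L M → ℝ}
    (h₁ : ∀ k, 0 ≤ ψ₁ k ∧ ψ₁ k ≤ 1 - hubbardCutoffWeightCT L M β μ K (klScale klE0 (n + 1)) k) (h₂ : ∀ k, 0 ≤ ψ₂ k) (hle : ∀ k, ψ₂ k ≤ ψ₁ k) :
    klShellOverlap L M β μ K n (ψ₁ - ψ₂) = 0 :=
  klShellOverlap_eq_zero_of_soft_succ β μ K n (abs_sub_le_one_sub_weight_of_ordered β μ K h₁ h₂ hle)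

/-- The `IsSoftSymbol` form of the pair lemma (both symbols admissible at `(K, n+1)`, ordered). -/
theorem klShellOverlap_eq_zero_of_isSoftSymbol_succ (n : ℕ) {ψ₁ ψ₂ : FreqMomentum L M → ℝ} (h₁ : IsSoftSymbol L M β μ K (n + 1) ψ₁)
    (h₂ : IsSoftSymbol L M β μ K (n + 1) ψ₂) (hle : ∀ k, ψ₂ k ≤ ψ₁ k) : klShellOverlap L M β μ K n (ψ₁ - ψ₂) = 0 :=
  klShellOverlap_eq_zero_of_ordered_succ β μ K n h₁.1 (fun k => (h₂.1 k).1) hle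

variable {R : RenConsts} {U : ℝ} {N : ℕ}

/-- At its own scale the born overlap of an ordered admissible pair is at most the soft mass, `≤ 15367` on a `FrameOK` frame (`klBetaMin ≤ β ≤ L`). -/
theorem klShellOverlap_sub_le_of_isSoftSymbol (hK : FrameOK R U N μ K) (hβ : klBetaMin ≤ β) (hβL : β ≤ L) (n : ℕ) {ψ₁ ψ₂ : FreqMomentum L M → ℝ}
    (h₁ : IsSoftSymbol L M β μ K n ψ₁) (h₂ : IsSoftSymbol L M β μ K n ψ₂) (hle : ∀ k, ψ₂ k ≤ ψ₁ k) :
    klShellOverlap L M β μ K n (ψ₁ - ψ₂) ≤ 15367 := by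
  have hβ0 : 0 < β := pos_of_klBetaMin_le hβ
  refine (klShellOverlap_le_klSoftMass β μ K hβ0 n _).trans ?_
  refine klSoftMass_le_of_frameOK hK hβ hβL n fun k => ⟨?_, ?_⟩
  · simp only [Pi.sub_apply]; linarith [hle k]
  · have := abs_sub_le_one_sub_weight_of_ordered β μ K h₁.1 (fun k => (h₂.1 k).1) hle k
    exact (le_abs_self _).trans this

/-- Likewise the soft mass of an ordered admissible pair's difference is `≤ 15367` at its own scale (the bridge constant). -/
theorem klSoftMass_sub_le_of_isSoftSymbol (hK : FrameOK R U N μ K) (hβ : klBetaMin ≤ β) (hβL : β ≤ L) (n : ℕ) {ψ₁ ψ₂ : FreqMomentum L M → ℝ}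
    (h₁ : IsSoftSymbol L M β μ K n ψ₁) (h₂ : IsSoftSymbol L M β μ K n ψ₂) (hle : ∀ k, ψ₂ k ≤ ψ₁ k) :
    klSoftMass L M β μ K n (ψ₁ - ψ₂) ≤ 15367 := by
  refine klSoftMass_le_of_frameOK hK hβ hβL n fun k => ⟨?_, ?_⟩
  · simp only [Pi.sub_apply]; linarith [hle k]
  · have := abs_sub_le_one_sub_weight_of_ordered β μ K h₁.1 (fun k => (h₂.1 k).1) hle k
    exact (le_abs_self _).trans this

omit [NeZero L] in
/-- And the difference of an ordered admissible pair is ITSELF admissible (`0 ≤ ψ₁ − ψ₂ ≤ 1 − w`, even) — so every sign/mass line of an admissible symbol applies to the relative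
weight `tₙ[ψ₁ − ψ₂]` (e.g. `klTransferWeight_nonpos_of_deep`). -/
theorem isSoftSymbol_sub_of_ordered {n : ℕ} {ψ₁ ψ₂ : FreqMomentum L M → ℝ} (h₁ : IsSoftSymbol L M β μ K n ψ₁) (h₂ : IsSoftSymbol L M β μ K n ψ₂)
    (hle : ∀ k, ψ₂ k ≤ ψ₁ k) : IsSoftSymbol L M β μ K n (ψ₁ - ψ₂) := by
  refine ⟨fun k => ⟨?_, ?_⟩, fun k => ?_⟩
  · simp only [Pi.sub_apply]; linarith [hle k]
  · simp only [Pi.sub_apply]; linarith [(h₁.1 k).2, (h₂.1 k).1]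
  · simp only [Pi.sub_apply, h₁.2 k, h₂.2 k]

end Overlap

end Summit.HubbardSuperconductivity.HubbardSuperconductivity.Theorems.KLRegimeSplit

end
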